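import Literature.AlgebraicGeometry.HodgeTheory.HodgeTypeOfFlatSections
import Literature.AlgebraicGeometry.HodgeTheory.InvariantClassesFromTotalSpaceHolds
import HarnessLib

/-!
# The Hodge type of a flat section is constant — UNCONDITIONALLY when the total space is smooth projective (Deligne, *Hodge II*, (4.1.3.1) with `X̄ = X`)

Family `hodge`, layer `Literature/AlgebraicGeometry/HodgeTheory`; theorems only (no definition, no
named fact, no `sorry`). Third file of the story `GlobalInvariantCycles` / `HodgeTypeOfFlatSections`.

`HodgeTypeOfFlatSections.lean` derives Deligne's

> (4.1.3.1) "Si une section globale `a` de `Rⁿf_*ℂ` est de type de Hodge `(p, q)` en un point, alors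
> `a` est de type `(p, q)` partout"

and Charles–Schnell's Prop. 11.3.5 (1) ("a flat section which is a Hodge class at one point is a Hodge
class at every point") from the NAMED FACT `deligne_globalInvariantCycles` (Hodge II, Thm. 4.1.1 (ii) =
Charles–Schnell Thm. 11.3.4: the invariants come from a smooth COMPACTIFICATION `X̄ ⊇ 𝒳`), through a
fact-free core (`isOfHodgeType_map_fiberι_of_isOfHodgeType_at`,
`isRationalClass_map_fiberι_of_isRationalClass_at`) valid for the fibre restrictions of any class of
any smooth projective `X̄` receiving a morphism `i : 𝒳 ⟶ X̄`. This file records the case in which NO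
named fact is needed at all: **when the total space `𝒳` is itself a smooth projective variety, take
`X̄ = 𝒳`, `i = 𝟙`.** Then

1. (§1, global classes) for every `A ∈ Hᵏ(𝒳(ℂ); ℂ)` the Hodge type and the rationality of `A|_{𝒳_s}`
   are constant in `s` (smooth base with `S(ℂ)` connected) — the core at `i = 𝟙`;
2. (§2, flat sections) if moreover `S` is quasi-projective, every continuous section `σ` of the espace
   étalé `FiberClass f k → S(ℂ)` of `Rᵏf_*ℂ` IS `s ↦ (s, A|_{𝒳_s})` for one `A ∈ Hᵏ(𝒳(ℂ); ℂ)` — Deligne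
   1968 / Voisin II Thm. 4.18 at one point, a tree THEOREM on quasi-projective carriers
   (`deligne1968_invariantClass_fromTotalSpace_holds`), plus the identity principle
   (`FiberClass.section_eq_of_eq_at_of_isSmoothProjectiveFamily`) — so (4.1.3.1) and Prop. 11.3.5 (1)
   hold for such families OUTRIGHT: `isOfHodgeType_of_isOfHodgeType_at_of_isSmoothProjective_total`,
   `mem_locusOfHodgeClasses_of_mem_at_of_isSmoothProjective_total`.

In Deligne's words (proof of Cor. 4.1.2, p. 42): "Si `S` est lisse, et si `X̄` est une compactification
lisse de `X`, alors d'après (4.1.1), le sous-espace `(Rⁿf_*ℚ)⁰_s` … est l'image de `Hⁿ(X̄, ℚ)`. Puisque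
l'application de restriction `Hⁿ(X̄, ℚ) → Hⁿ(X_s, ℚ)` est un morphisme de structures de Hodge, son image
est une sous-structure de Hodge et la structure de Hodge induite sur `H⁰(S, Rⁿf_*ℚ)`, quotient de celle
de `Hⁿ(X̄, ℚ)`, est indépendante de `s`" — here `X̄ = X` is already smooth projective, and the surjectivity
`Hⁿ(X) ↠ H⁰(S, Rⁿf_*)` is Deligne 1968 (degeneration of Leray, (4.1.1) (i)), which the tree PROVES on
quasi-projective carriers; the mixed-Hodge-theoretic half (4.1.1) (ii) of the partie fixe — the tree's
undischarged `deligne_globalInvariantCycles`, equivalently Voisin II Prop. 4.23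
(`voisin2003_rangeRestrict_eq_of_compactification`) — is simply not needed when `X` is compact. The
compact case is the one Deligne credits to Griffiths ((4.1.3): "Dans le cas où `S` est compact, une
généralisation de (4.1.2) est prouvée par voie analytique dans Griffiths [5]"; (4.1.3.1) is labelled
"(Griffiths [5])" = [Griffiths1970]); the proof below is Deligne's algebraic one at `X̄ = X`, not
Griffiths' curvature argument. (Re-read this session: [corpus: paper:url-844aebd4b2c4 p0039 L15–36].)

Where this applies: smooth projective families `f : 𝒳 ⟶ S` whose total space is projective — e.g.
André's compact pencils of abelian varieties (`Motives.IsCompactAbelianPencil`: `𝒳` smooth projective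
of dimension `d + 1` over a smooth projective curve), universal families over compact Shimura curves,
any smooth projective family over a smooth projective base. Consumer: the Summits-side
`Ring2HypothesesFlatSectionsAnchoredNodes` (cell `pub-hodge-ring2`, row b04), where it makes the
anchored (printed) form of the variational Hodge conjecture on compact pencils coincide with the
tree's "Hodge everywhere" form WITHOUT the global invariant cycle theorem.

What is NOT here: anything for non-compact total spaces (that is `HodgeTypeOfFlatSections.lean`,
modulo `deligne_globalInvariantCycles`); no polarisation, no semisimplicity, no mixed Hodge theory.

## References

* [DeligneHodgeII1971] P. Deligne, Théorie de Hodge II, Publ. Math. IHÉS 40 (1971), Thm. 4.1.1,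
  Cor. 4.1.2 and its proof, (4.1.3.1) (pp. 41–42).
* [CharlesSchnell2014Notes] F. Charles, C. Schnell, Notes on absolute Hodge classes, in *Hodge
  Theory* (Princeton Math. Notes 49, 2014), Thm. 11.3.4, Prop. 11.3.5 (1) (book pp. 469–471).
* [VoisinHodgeII2003] C. Voisin, Hodge Theory and Complex Algebraic Geometry II (2003), Thm. 4.18,
  Lemma 4.17, Thm. 4.24.
* [Deligne1968] P. Deligne, Théorème de Lefschetz et critères de dégénérescence de suites
  spectrales, Publ. Math. IHÉS 35 (1968), Prop. (2.1).
* [VoisinHodgeI2002] C. Voisin, Hodge Theory and Complex Algebraic Geometry I (2002), §7.3.2.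
* [Griffiths1970] P. A. Griffiths, Periods of integrals on algebraic manifolds III, Publ. Math. IHÉS
  38 (1970), 125–180 (the compact-base case, as credited in Hodge II (4.1.3)).
-/

noncomputable section

open CategoryTheory AlgebraicGeometry
open Literature.AlgebraicTopology.SingularHomology

namespace Literature.AlgebraicGeometry.HodgeTheory

section HodgeTheory

/-! ### 1. Global classes of a smooth projective total space: the fact-free core at `i = 𝟙` -/

section GlobalClasses

variable {𝒳 S : Motives.SchemeOver ℂ} (f : 𝒳 ⟶ S) {n m : ℕ}

/-- **(4.1.3.1) for global classes of a smooth PROJECTIVE total space, no named fact.** Let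
`f : 𝒳 ⟶ S` be a smooth projective family of relative dimension `n` over a smooth `S` with `S(ℂ)`
connected, the total space `𝒳` being a smooth projective variety (of some dimension `m`), and
`A ∈ Hᵏ(𝒳(ℂ); ℂ)`. If `A|_{𝒳_{s₀}}` is of Hodge type `(p, q)` for one `s₀`, then `A|_{𝒳_s}` is of Hodge
type `(p, q)` for every `s` — the core `isOfHodgeType_map_fiberι_of_isOfHodgeType_at` with `X̄ = 𝒳`,
`i = 𝟙` (the `(p,q)`-component of `A` in the Hodge decomposition of `𝒳` restricts like `A` at `s₀`,
hence everywhere by kernel constancy, and restrictions between smooth projective varieties preserve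
types). [cite: DeligneHodgeII1971, (4.1.3.1) and Cor. 4.1.2 (proof)] [cite: VoisinHodgeI2002, §7.3.2] -/
theorem isOfHodgeType_map_fiberι_of_isOfHodgeType_at_of_isSmoothProjective_total
    (hf : Motives.IsSmoothProjectiveFamily f n) [Smooth S.hom]
    [ConnectedSpace (Motives.ComplexPoints S)] (h𝒳 : Motives.IsSmoothProjective m 𝒳) {k p q : ℕ}
    (A : complexBetti 𝒳 k) {s₀ : Motives.ComplexPoints S}
    (h₀ : IsOfHodgeType n (Motives.fiberOver f s₀) k p q (complexBetti.map (Motives.fiberι f s₀) k A))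
    (s : Motives.ComplexPoints S) :
    IsOfHodgeType n (Motives.fiberOver f s) k p q (complexBetti.map (Motives.fiberι f s) k A) := by
  have hA : complexBetti.map (𝟙 𝒳) k A = A := by rw [complexBetti.map_id]; rfl
  have h := isOfHodgeType_map_fiberι_of_isOfHodgeType_at f (𝟙 𝒳) hf h𝒳 A (s₀ := s₀) (p := p) (q := q)
    (by rw [hA]; exact h₀) s
  rwa [hA] at h

/-- **Rationality of the fibre restrictions of a class of a smooth projective total space is constant
along the family, no named fact** (`isRationalClass_map_fiberι_of_isRationalClass_at` with `X̄ = 𝒳`,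
`i = 𝟙`: rational descent of the range of `Hᵏ(𝒳(ℂ); ℂ) → Hᵏ(𝒳_{s₀}(ℂ); ℂ)`, kernel constancy, and
rational classes pull back to rational classes). [cite: DeligneHodgeII1971, Cor. 4.1.2 (proof)]
[cite: VoisinHodgeI2002, §7.1.1] -/
theorem isRationalClass_map_fiberι_of_isRationalClass_at_of_isSmoothProjective_total
    (hf : Motives.IsSmoothProjectiveFamily f n) [Smooth S.hom]
    [ConnectedSpace (Motives.ComplexPoints S)] (h𝒳 : Motives.IsSmoothProjective m 𝒳) {k : ℕ}
    (A : complexBetti 𝒳 k) {s₀ : Motives.ComplexPoints S}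
    (h₀ : IsRationalClass (complexBetti.map (Motives.fiberι f s₀) k A)) (s : Motives.ComplexPoints S) :
    IsRationalClass (complexBetti.map (Motives.fiberι f s) k A) := by
  have hA : complexBetti.map (𝟙 𝒳) k A = A := by rw [complexBetti.map_id]; rfl
  have h := isRationalClass_map_fiberι_of_isRationalClass_at f (𝟙 𝒳) hf h𝒳 A (s₀ := s₀)
    (by rw [hA]; exact h₀) s
  rwa [hA] at h

/-- **The locus of Hodge classes along the global section of a class of a smooth projective total
space, no named fact**: if `(s₀, A|_{𝒳_{s₀}})` lies in the locus of Hodge classes (rational of type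
`(p, p)`) then `(s, A|_{𝒳_s})` does for every `s`. [cite: DeligneHodgeII1971, (4.1.3.1)]
[cite: CharlesSchnell2014Notes, Proposition 11.3.5 (1)] -/
theorem globalSection_mem_locusOfHodgeClasses_of_mem_at_of_isSmoothProjective_total
    (hf : Motives.IsSmoothProjectiveFamily f n) [Smooth S.hom]
    [ConnectedSpace (Motives.ComplexPoints S)] (h𝒳 : Motives.IsSmoothProjective m 𝒳) {p : ℕ}
    (A : complexBetti 𝒳 (2 * p)) {s₀ : Motives.ComplexPoints S}
    (h₀ : globalSection f (2 * p) A s₀ ∈ locusOfHodgeClasses f n p) (s : Motives.ComplexPoints S) :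
    globalSection f (2 * p) A s ∈ locusOfHodgeClasses f n p :=
  ⟨isRationalClass_map_fiberι_of_isRationalClass_at_of_isSmoothProjective_total f hf h𝒳 A h₀.1 s,
    isOfHodgeType_map_fiberι_of_isOfHodgeType_at_of_isSmoothProjective_total f hf h𝒳 A h₀.2 s⟩

/-- The same two constancies bundled in the shape the variational statements quantify ("`A|_{𝒳_s}` is
rational of type `(p,p)` for every `s`" from ONE `s₀`), smooth projective total space, no named fact.
[cite: DeligneHodgeII1971, (4.1.3.1)] [cite: CharlesSchnell2014Notes, Proposition 11.3.5 (1)] -/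
theorem forall_isRationalClass_and_isOfHodgeType_of_at_of_isSmoothProjective_total
    (hf : Motives.IsSmoothProjectiveFamily f n) [Smooth S.hom]
    [ConnectedSpace (Motives.ComplexPoints S)] (h𝒳 : Motives.IsSmoothProjective m 𝒳) {p : ℕ}
    (A : complexBetti 𝒳 (2 * p)) {s₀ : Motives.ComplexPoints S}
    (hrat : IsRationalClass (complexBetti.map (Motives.fiberι f s₀) (2 * p) A))
    (htype : IsOfHodgeType n (Motives.fiberOver f s₀) (2 * p) p p
      (complexBetti.map (Motives.fiberι f s₀) (2 * p) A))
    (s : Motives.ComplexPoints S) :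
    IsRationalClass (complexBetti.map (Motives.fiberι f s) (2 * p) A) ∧
      IsOfHodgeType n (Motives.fiberOver f s) (2 * p) p p (complexBetti.map (Motives.fiberι f s) (2 * p) A) :=
  ⟨isRationalClass_map_fiberι_of_isRationalClass_at_of_isSmoothProjective_total f hf h𝒳 A hrat s,
    isOfHodgeType_map_fiberι_of_isOfHodgeType_at_of_isSmoothProjective_total f hf h𝒳 A htype s⟩

end GlobalClasses

/-! ### 2. Flat sections: Deligne 1968 is a tree theorem on quasi-projective carriers -/

section FlatSections

variable {𝒳 S : Motives.SchemeOver ℂ} (f : 𝒳 ⟶ S) {n m : ℕ}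

/-- **A continuous section of `FiberClass f k → S(ℂ)` is the global section of ONE class of the total
space, at EVERY point — no named fact** (quasi-projective total space and base, smooth base with
`S(ℂ)` connected): Deligne 1968 / Voisin II Thm. 4.18 at one point `s₀` — the tree THEOREM
`deligne1968_invariantClass_fromTotalSpace_holds` — gives `A ∈ Hᵏ(𝒳(ℂ); ℂ)` with
`σ(s₀) = (s₀, A|_{𝒳_{s₀}})`, and the identity principle for continuous sections of the local system
`Rᵏf_*ℂ` (`FiberClass.section_eq_of_eq_at_of_isSmoothProjectiveFamily`, Voisin II Lemma 4.17) gives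
`σ(s) = (s, A|_{𝒳_s})` for all `s`. (Literature twin of the Summits-side
`Ring2.Hypotheses.exists_globalSection_eq_of_flatSection`; the fact-free analogue of
`deligne_globalInvariantCycles.exists_forall_eq_globalSection`, with the open total space in place of
the compactification.) [cite: VoisinHodgeII2003, Thm. 4.18 and Lemma 4.17] [cite: Deligne1968, Prop. (2.1)]
[cite: CharlesSchnell2014Notes, proof of Prop. 11.3.5 ("since S is connected")] -/
theorem exists_forall_eq_globalSection_of_isQuasiProjectiveOver
    (hf : Motives.IsSmoothProjectiveFamily f n) (h𝒳 : IsQuasiProjectiveOver 𝒳)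
    (hS : IsQuasiProjectiveOver S) [Smooth S.hom] [ConnectedSpace (Motives.ComplexPoints S)] {k : ℕ}
    {σ : Motives.ComplexPoints S → FiberClass f k} (hσ : Continuous σ) (hpt : ∀ s, (σ s).pt = s)
    (s₀ : Motives.ComplexPoints S) :
    ∃ A : complexBetti 𝒳 k, ∀ s, σ s = globalSection f k A s := by
  obtain ⟨A, hA⟩ := deligne1968_invariantClass_fromTotalSpace_holds 𝒳 S f n hf h𝒳 hS ‹_› k σ hσ hpt s₀
  exact ⟨A, FiberClass.section_eq_of_eq_at_of_isSmoothProjectiveFamily f k hf hσ hpt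
    (continuous_globalSection f k A) (fun _ => rfl) hA⟩

/-- **Deligne, Hodge II, (4.1.3.1) — UNCONDITIONAL for a smooth projective family whose total space
is a smooth projective variety** (base smooth, quasi-projective, `S(ℂ)` connected): a continuous
section `σ` of `FiberClass f k → S(ℂ)` of Hodge type `(p, q)` at one point is of type `(p, q)` at every
point. `σ` is the global section of a class `A` of `𝒳` (`exists_forall_eq_globalSection_of_isQuasiProjectiveOver`;
`𝒳` is quasi-projective as a projective scheme), and §1 applies to `A`. No compactification, no
partie fixe (ii), no named fact. [cite: DeligneHodgeII1971, (4.1.3), (4.1.3.1) and Cor. 4.1.2]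
[cite: Griffiths1970] [cite: VoisinHodgeII2003, Thm. 4.18] -/
theorem isOfHodgeType_of_isOfHodgeType_at_of_isSmoothProjective_total
    (hf : Motives.IsSmoothProjectiveFamily f n) (h𝒳 : Motives.IsSmoothProjective m 𝒳)
    (hS : IsQuasiProjectiveOver S) [Smooth S.hom] [ConnectedSpace (Motives.ComplexPoints S)]
    {k p q : ℕ} {σ : Motives.ComplexPoints S → FiberClass f k} (hσ : Continuous σ)
    (hpt : ∀ s, (σ s).pt = s) {s₀ : Motives.ComplexPoints S}
    (h₀ : IsOfHodgeType n (Motives.fiberOver f (σ s₀).pt) k p q (σ s₀).cls)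
    (s : Motives.ComplexPoints S) :
    IsOfHodgeType n (Motives.fiberOver f (σ s).pt) k p q (σ s).cls := by
  obtain ⟨A, hall⟩ := exists_forall_eq_globalSection_of_isQuasiProjectiveOver f hf
    (IsQuasiProjectiveOver.of_isProjectiveOver h𝒳.isProjectiveOver) hS hσ hpt s₀
  rw [hall s₀] at h₀
  rw [hall s]
  exact isOfHodgeType_map_fiberι_of_isOfHodgeType_at_of_isSmoothProjective_total f hf h𝒳 A h₀ s

/-- **Charles–Schnell, Prop. 11.3.5 (1) — UNCONDITIONAL for a smooth projective family whose total
space is a smooth projective variety** (base smooth, quasi-projective, `S(ℂ)` connected): a continuous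
section `σ : S(ℂ) → FiberClass f (2p)` which is a Hodge class (rational of type `(p, p)`) at ONE point
lies in the locus of Hodge classes at EVERY point. Neither the rational-everywhere hypothesis of the
vendored `charlesSchnell_hodgeClass_of_flat` nor the global invariant cycle theorem
`deligne_globalInvariantCycles` is used. [cite: CharlesSchnell2014Notes, Proposition 11.3.5 (1)]
[cite: DeligneHodgeII1971, (4.1.3.1)] [cite: VoisinHodgeII2003, Thm. 4.18] -/
theorem mem_locusOfHodgeClasses_of_mem_at_of_isSmoothProjective_total
    (hf : Motives.IsSmoothProjectiveFamily f n) (h𝒳 : Motives.IsSmoothProjective m 𝒳)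
    (hS : IsQuasiProjectiveOver S) [Smooth S.hom] [ConnectedSpace (Motives.ComplexPoints S)] {p : ℕ}
    {σ : Motives.ComplexPoints S → FiberClass f (2 * p)} (hσ : Continuous σ) (hpt : ∀ s, (σ s).pt = s)
    {s₀ : Motives.ComplexPoints S} (h₀ : σ s₀ ∈ locusOfHodgeClasses f n p)
    (s : Motives.ComplexPoints S) : σ s ∈ locusOfHodgeClasses f n p := by
  obtain ⟨A, hall⟩ := exists_forall_eq_globalSection_of_isQuasiProjectiveOver f hf
    (IsQuasiProjectiveOver.of_isProjectiveOver h𝒳.isProjectiveOver) hS hσ hpt s₀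
  rw [hall s₀] at h₀
  rw [hall s]
  exact globalSection_mem_locusOfHodgeClasses_of_mem_at_of_isSmoothProjective_total f hf h𝒳 A h₀ s

/-- The same over a smooth IRREDUCIBLE quasi-projective base (`S(ℂ)` is then connected, SGA1 XII 2.4
`ComplexPoints.connectedSpace_iff_holds`) — the carrier convention of the Summits-side nodes.
[cite: CharlesSchnell2014Notes, Proposition 11.3.5 (1)] [cite: DeligneHodgeII1971, (4.1.3.1)] -/
theorem mem_locusOfHodgeClasses_of_mem_at_of_isSmoothProjective_total_of_irreducible
    (hf : Motives.IsSmoothProjectiveFamily f n) (h𝒳 : Motives.IsSmoothProjective m 𝒳)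
    (hS : IsQuasiProjectiveOver S) [Smooth S.hom] [IrreducibleSpace S.left] {p : ℕ}
    {σ : Motives.ComplexPoints S → FiberClass f (2 * p)} (hσ : Continuous σ) (hpt : ∀ s, (σ s).pt = s)
    {s₀ : Motives.ComplexPoints S} (h₀ : σ s₀ ∈ locusOfHodgeClasses f n p)
    (s : Motives.ComplexPoints S) : σ s ∈ locusOfHodgeClasses f n p := by
  haveI : LocallyOfFiniteType S.hom := inferInstance
  haveI : ConnectedSpace (Motives.ComplexPoints S) :=
    (Motives.ComplexPoints.connectedSpace_iff_holds S).2 inferInstance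
  exact mem_locusOfHodgeClasses_of_mem_at_of_isSmoothProjective_total f hf h𝒳 hS hσ hpt h₀ s

end FlatSections

end HodgeTheory

/-! ## Audit

No definition, no named fact, no `sorry`. Relies on the tree THEOREMS
`deligne1968_invariantClass_fromTotalSpace_holds` (Deligne 1968 on quasi-projective carriers),
`nonempty_hodgeModel_holds`, `hodgePQ_independent_of_hodgeModel_holds`, `ComplexPoints.connectedSpace_iff_holds`
through `HodgeTypeOfFlatSections`; axiom closures are the three standard axioms. -/

#print axioms Literature.AlgebraicGeometry.HodgeTheory.mem_locusOfHodgeClasses_of_mem_at_of_isSmoothProjective_total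
#print axioms Literature.AlgebraicGeometry.HodgeTheory.isOfHodgeType_of_isOfHodgeType_at_of_isSmoothProjective_total

end Literature.AlgebraicGeometry.HodgeTheory

end
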